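import Summits.Ventures.PercRepro.RankLevelSetDepCountGen
import Summits.Ventures.PercRepro.RankLevelSetLevelFive
import Summits.Ventures.PercRepro.RankLevelSetDepCountGiantB2
import Summits.Ventures.PercRepro.RankLevelSetLevelFiveArithThreeA
import Summits.Ventures.PercRepro.RankLevelSetLevelFiveArithThreeB
import Summits.Ventures.PercRepro.RankLevelSetLevelFiveArithThreeC
import Summits.Ventures.PercRepro.RankLevelSetLevelFiveGiant
import Summits.Ventures.PercRepro.RankLevelSetLevelSplitAll
import Summits.Ventures.PercRepro.S1LevelFour
import Summits.Ventures.PercRepro.S1TriangleCount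
import Summits.Ventures.PercRepro.S1FourCircuitCount
import Summits.Ventures.PercRepro.RankLevelSetPlaneTenPrime
import Summits.Ventures.PercRepro.RankLevelSetCoreFiveNineteen
import Summits.Ventures.PercRepro.RankLevelSetCorankFiveCounts
import Summits.Ventures.PercRepro.S2FiveWindow
import Summits.Ventures.PercRepro.S2FlatTail
import Summits.Ventures.PercRepro.S2FlatTailBounds
import Summits.Ventures.PercRepro.S2FlatTailBounds16
import Summits.Ventures.PercRepro.S2TailThreeD
import Summits.Ventures.PercRepro.S2CellsII3C
import Summits.Ventures.PercRepro.RankLevelSetCoreFiveTwentyNine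
import Summits.Ventures.PercRepro.S2SquareGiantCount3D
import Summits.Ventures.PercRepro.S2ThreeAux
import Summits.Ventures.PercRepro.RankLevelSetLevelFiveMult

/-!
# PercRepro — THEOREM C₅ AT `31`: C-025 AT LEVEL `5` FOR EVERY FINITE MATROID AND EVERY `p ≥ 31`
(p7, gen 2; sub-claim S2 — the «31» chain)

`proofs/SUBCLAIM-S2-p7.md` R3′. The `U`-side: the SHARPENED multiplicity `ν + 3·C(ν, 2)` (S2SquareMultiplicity3: under
`lines ≤ 3 points` every pair of elements outside a basis has three exchange points) in the PARTITION form
(`S2.ncard_eRk_eq_ncard_le_le_giant_three'`, S2SquareGiantCount3), with the nullity cap, `f(5) ≤ 19`, Lemmas T and T4.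
The `Y`-side: the STRUCTURED flat tail — the sets of rank `≤ 4` through their closures (S2FlatTail) and the rank-`5` sets
by the same level count with the size bound `5 + d` (`ncard_eRk_eq_ncard_le_le_giant_three_D`; the nullity cap), so
`16·(#{r ≤ 5} + #spanning) ≤ 2^n` from `n ≥ 30 + d` (coranks `6 … 18`) resp. `n ≥ 2d + 14` (`19 … 25`) (S2TailThreeA/B);
below those bases — the 42 cells `(p, d)`, `19 ≤ d ≤ 25`, `30 ≤ p ≤ d + 13` — ONE middle binomial `#Y ≥ C(n, s)`
(`choose_le_midCount_of_bound'`) with the numeral cells S2CellsII3A/B. The polynomial inequalities: the `15/16` form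
`level_five_poly_three` at `p ≥ 30` for every corank `6 … 25` (RankLevelSetLevelFiveArithThreeA/B/C); coranks `≥ 26` by
`c025_core_five_nineteen` (`p ≥ 27`).

* **`c025_core_five_bounded_corank_three`** — the `e`-free core at level `5`, corank `6 ≤ d ≤ 25`, rank `p ≥ 30`;
* **`c025_five_of_four_three_from`** — for `P ≥ 30`, level `4` for all `p ≥ P` implies level `5` for all `p ≥ P + 1`;
* **`c025_five_large_three31`** — UNCONDITIONAL over the landed tree: C-025 at level `5` for every `p ≥ 31` (level `4`
  from S1's `c025_four_twentyseven`, `p ≥ 27`); `c025_five_large_three31'` is the `C025` spelling.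
Axioms: standard.
-/

open scoped Matroid

namespace PercRepro

namespace ThmN

open Set

variable {α : Type}

/-- **The `e`-free core at level `5`, corank `6 ≤ d ≤ 25`, rank `p ≥ 30`** (the sharpened multiplicity in the partition
form, the nullity cap, `f(5) ≤ 19`, Lemmas T and T4, the structured flat tail / the middle-binomial count). -/
theorem c025_core_five_bounded_corank_three (M : Matroid α) [M.Finite] (p d : ℕ) (hp : 30 ≤ p) (hd6 : 6 ≤ d)
    (hd25 : d ≤ 25) (hR : M.eRank = (p : ℕ∞)) (hn : M.E.ncard = p + d)
    (hfree : ∀ e ∈ M.E, ∃ A ⊆ M.E \ {e}, e ∉ M.closure A ∧ e ∉ M.closure ((M.E \ {e}) \ A)) :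
    RLS M p 5 := by
  classical
  have hEcard : M.ground_finite.toFinset.card = p + d := by
    rw [← Set.ncard_eq_toFinset_card _ M.ground_finite]; exact hn
  -- the core is simple: every circuit has `≥ 3` elements
  have hL0 : ∀ e ∈ M.E, ¬ M.IsLoop e := not_isLoop_of_free M hfree
  have hs : ∀ e ∈ M.E, ∀ f ∈ M.E, e ≠ f → M.eRk {e, f} = 2 := by
    intro e he f hf hef
    have h2 : (2 : ℕ∞) ≤ M.eRk {e, f} :=
      two_le_eRk_of_two_le_ncard_of_free M hfree (pair_subset he hf) (by rw [ncard_pair hef])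
    have h3 : M.eRk {e, f} ≤ 2 := by
      have := M.eRk_le_encard {e, f}
      rwa [encard_pair hef] at this
    exact le_antisymm h3 h2
  have hcirc : ∀ C, M.IsCircuit C → 3 ≤ C.encard := three_le_encard_of_circuit M hL0 hs
  have hd : M.E.encard = M.eRank + d := by
    rw [hR, ← M.ground_finite.cast_ncard_eq, hn]
    push_cast
    ring
  -- the capped flat bounds: rank-`≤ 5` sets have `≤ min 19 (5 + d)` points, rank-`≤ 4` sets `≤ min 10 (4 + d)`
  have hflat : ∀ X ⊆ M.E, M.eRk X ≤ 5 → X.ncard ≤ min 19 (5 + d) := fun X hX hr =>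
    le_min (ncard_le_nineteen_of_eRk_le_five_of_free M hfree hX hr)
      (ncard_le_add_of_eRk_le_of_encard_eq M hd hX hr)
  have hflat' : ∀ X ⊆ M.E, M.eRk X ≤ ((5 - 1 : ℕ) : ℕ∞) → X.ncard ≤ min 10 (4 + d) := fun X hX hr =>
    le_min (ncard_le_ten_of_eRk_le_four_of_free M hfree hX (by simpa using hr))
      (ncard_le_add_of_eRk_le_of_encard_eq M hd hX (by simpa using hr))
  -- the circuit counts: Lemma T, Lemma T4, and the nullity bounds
  have hC1 : ∀ L ⊆ M.E, M.eRk L = 2 → L.ncard ≤ 3 :=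
    fun L hL hr => ncard_le_three_of_eRk_two M hs hfree hL hr
  have hC1' : ∀ L ⊆ M.E, M.eRk L ≤ 2 → L.ncard ≤ 3 := fun L hL hr => by
    have := ncard_add_one_le_two_pow_of_eRk_le M hL0 hfree 2 L hL hr
    omega
  have hC2 : ∀ P ⊆ M.E, M.eRk P ≤ 3 → P.ncard ≤ 6 :=
    fun P hP hr => ncard_le_six_of_eRk_le_three_of_free M hfree hP hr
  have hs3 : {C | M.IsCircuit C ∧ C.ncard = 3}.ncard ≤ d * (d + 1) / 2 := by
    have := S1.two_mul_ncard_triangles_le M hC1 hd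
    unfold triangles at this
    omega
  have hs4 : {C | M.IsCircuit C ∧ C.ncard = 4}.ncard ≤ d * (d + 1) * (d + 2) / 3 := by
    have := S1.three_mul_ncard_four_circuits_le M hC1' hC2 hd
    omega
  have hs5 : {C | M.IsCircuit C ∧ C.ncard = 5}.ncard ≤ (d + 4).choose 5 :=
    Matroid.ncard_circuits_le_choose_of_encard M hd 4
  have hs6 : {C | M.IsCircuit C ∧ C.ncard = 6}.ncard ≤ (d + 5).choose 6 :=
    Matroid.ncard_circuits_le_choose_of_encard M hd 5
  -- (U): the square-multiplicity count in the PARTITION form, in `ℚ`, then the circuit bounds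
  set ν₁ : ℕ := (d + 6) / 2 + 1 with hν₁
  have hU0 := S2.ncard_eRk_eq_ncard_le_le_giant_three' M 5 (min 19 (5 + d)) (min 10 (4 + d)) ν₁ 6 (by norm_num)
    hcirc hC1 hflat hflat' (hinter_five M hfree) hd (by omega) (by omega) (by omega)
  have hU1 := Matroid.topCount_le_ncard_compl (M := M) hR hd 5
  have hm1 : min (min 19 (5 + d) - 6) (ν₁ - 2) = min 13 ((d + 6) / 2 + 1 - 2) := by omega
  have hm2 : min 10 (4 + d) - 5 = min 5 (d - 1) := by omega
  have hm3 : min (min 19 (5 + d)) (5 + d) = min 19 (5 + d) := by omega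
  simp only [show (5 : ℕ) + 1 = 6 from rfl] at hU0
  rw [hn, sum_Icc_three_six_q, sum_Icc_three_six_q, hm1, hm2, hm3,
    show d - 6 + 1 = d - 5 by omega] at hU0
  simp only [show (6 : ℕ) - 3 = 3 from rfl, show (6 : ℕ) - 4 = 2 from rfl,
    show (6 : ℕ) - 5 = 1 from rfl, show (6 : ℕ) - 6 = 0 from rfl, Nat.choose_one_right,
    Nat.choose_zero_right] at hU0
  have hUq : (Matroid.topCount M p 5 : ℚ) ≤ ((p + d).choose 5 : ℚ) +
      (∑ j ∈ Finset.range (d - 5), (Nat.choose (min 13 ((d + 6) / 2 + 1 - 2)) j : ℚ) / (((j + 1) + 3 * (j + 1).choose 2 : ℕ) : ℚ)) *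
        ((d * (d + 1) / 2 * (p + d).choose 3 + d * (d + 1) * (d + 2) / 3 * (p + d).choose 2 +
          (d + 4).choose 5 * (p + d) + (d + 5).choose 6 : ℕ) : ℚ) +
      ((∑ j ∈ Finset.range (d - 5), (Nat.choose (min 19 (5 + d) - 6) j : ℚ) / (((j + 1) + 3 * (j + 1).choose 2 : ℕ) : ℚ)) -
        (∑ j ∈ Finset.range (d - 5), (Nat.choose (min 5 (d - 1)) j : ℚ) / (((j + 1) + 3 * (j + 1).choose 2 : ℕ) : ℚ))) *
        ((d * (d + 1) / 2 * (min 19 (5 + d)).choose 3 + d * (d + 1) * (d + 2) / 3 * (min 19 (5 + d)).choose 2 +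
          (d + 4).choose 5 * (min 19 (5 + d)) + (d + 5).choose 6 : ℕ) : ℚ) := by
    have hU1q : (Matroid.topCount M p 5 : ℚ) ≤
        ({B : Set α | B ⊆ M.E ∧ M.eRk B = 5 ∧ B.ncard ≤ d}.ncard : ℚ) := by exact_mod_cast hU1
    have hsm : {C | M.IsCircuit C ∧ C.ncard = 3}.ncard * (p + d).choose 3 +
        {C | M.IsCircuit C ∧ C.ncard = 4}.ncard * (p + d).choose 2 +
        {C | M.IsCircuit C ∧ C.ncard = 5}.ncard * (p + d) + {C | M.IsCircuit C ∧ C.ncard = 6}.ncard * 1 ≤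
        d * (d + 1) / 2 * (p + d).choose 3 + d * (d + 1) * (d + 2) / 3 * (p + d).choose 2 +
          (d + 4).choose 5 * (p + d) + (d + 5).choose 6 := by
      have := hs6
      gcongr
      omega
    have hgg : {C | M.IsCircuit C ∧ C.ncard = 3}.ncard * (min 19 (5 + d)).choose 3 +
        {C | M.IsCircuit C ∧ C.ncard = 4}.ncard * (min 19 (5 + d)).choose 2 +
        {C | M.IsCircuit C ∧ C.ncard = 5}.ncard * (min 19 (5 + d)) + {C | M.IsCircuit C ∧ C.ncard = 6}.ncard * 1 ≤
        d * (d + 1) / 2 * (min 19 (5 + d)).choose 3 + d * (d + 1) * (d + 2) / 3 * (min 19 (5 + d)).choose 2 +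
          (d + 4).choose 5 * (min 19 (5 + d)) + (d + 5).choose 6 := by
      gcongr
      omega
    have hsmq : (({C | M.IsCircuit C ∧ C.ncard = 3}.ncard : ℚ) * ((p + d).choose 3 : ℚ) +
        ({C | M.IsCircuit C ∧ C.ncard = 4}.ncard : ℚ) * ((p + d).choose 2 : ℚ) +
        ({C | M.IsCircuit C ∧ C.ncard = 5}.ncard : ℚ) * ((p + d : ℕ) : ℚ) +
        ({C | M.IsCircuit C ∧ C.ncard = 6}.ncard : ℚ) * ((1 : ℕ) : ℚ)) ≤
        ((d * (d + 1) / 2 * (p + d).choose 3 + d * (d + 1) * (d + 2) / 3 * (p + d).choose 2 +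
          (d + 4).choose 5 * (p + d) + (d + 5).choose 6 : ℕ) : ℚ) := by exact_mod_cast hsm
    have hggq : (({C | M.IsCircuit C ∧ C.ncard = 3}.ncard : ℚ) * ((min 19 (5 + d)).choose 3 : ℚ) +
        ({C | M.IsCircuit C ∧ C.ncard = 4}.ncard : ℚ) * ((min 19 (5 + d)).choose 2 : ℚ) +
        ({C | M.IsCircuit C ∧ C.ncard = 5}.ncard : ℚ) * ((min 19 (5 + d) : ℕ) : ℚ) +
        ({C | M.IsCircuit C ∧ C.ncard = 6}.ncard : ℚ) * ((1 : ℕ) : ℚ)) ≤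
        ((d * (d + 1) / 2 * (min 19 (5 + d)).choose 3 + d * (d + 1) * (d + 2) / 3 * (min 19 (5 + d)).choose 2 +
          (d + 4).choose 5 * (min 19 (5 + d)) + (d + 5).choose 6 : ℕ) : ℚ) := by exact_mod_cast hgg
    -- `σ_s ≤ σ_g` (termwise), so the giant excess is non-negative
    have hσ : (∑ j ∈ Finset.range (d - 5), (Nat.choose (min 5 (d - 1)) j : ℚ) / (((j + 1) + 3 * (j + 1).choose 2 : ℕ) : ℚ)) ≤
        ∑ j ∈ Finset.range (d - 5), (Nat.choose (min 19 (5 + d) - 6) j : ℚ) / (((j + 1) + 3 * (j + 1).choose 2 : ℕ) : ℚ) := by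
      apply Finset.sum_le_sum
      intro j _
      have : (min 5 (d - 1)).choose j ≤ (min 19 (5 + d) - 6).choose j := Nat.choose_le_choose j (by omega)
      have h' : ((min 5 (d - 1)).choose j : ℚ) ≤ ((min 19 (5 + d) - 6).choose j : ℚ) := by exact_mod_cast this
      exact div_le_div_of_nonneg_right h' (by positivity)
    have hσm0 : (0 : ℚ) ≤ ∑ j ∈ Finset.range (d - 5), (Nat.choose (min 13 ((d + 6) / 2 + 1 - 2)) j : ℚ) / (((j + 1) + 3 * (j + 1).choose 2 : ℕ) : ℚ) :=
      Finset.sum_nonneg (fun j _ => by positivity)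
    refine hU1q.trans (hU0.trans ?_)
    have e1 := mul_le_mul_of_nonneg_left hsmq hσm0
    have e2 := mul_le_mul_of_nonneg_left hggq (by linarith : (0 : ℚ) ≤
      (∑ j ∈ Finset.range (d - 5), (Nat.choose (min 19 (5 + d) - 6) j : ℚ) / (((j + 1) + 3 * (j + 1).choose 2 : ℕ) : ℚ)) -
        (∑ j ∈ Finset.range (d - 5), (Nat.choose (min 5 (d - 1)) j : ℚ) / (((j + 1) + 3 * (j + 1).choose 2 : ℕ) : ℚ)))
    linarith
  -- (Y): the STRUCTURED flat tail — ranks `≤ 4` through their closures, rank `5` by the level count at `D = 5 + d`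
  have hY := Matroid.two_pow_le_midCount_add (M := M) p 5 hR
  have hsum5 := S2.ncard_eRk_le_le_sum M 5
  simp only [Finset.sum_range_succ, Finset.sum_range_zero, zero_add] at hsum5
  have h4 : {X : Set α | X ⊆ M.E ∧ M.eRk X = (4 : ℕ)}.ncard ≤ M.E.ncard.choose 4 * 2 ^ (10 - 4) :=
    S2.ncard_eRk_eq_le_choose_mul_two_pow M 4 10
      (fun X hX hr => ncard_le_ten_of_eRk_le_four_of_free M hfree hX (by exact_mod_cast hr))
  have h3 : {X : Set α | X ⊆ M.E ∧ M.eRk X = (3 : ℕ)}.ncard ≤ M.E.ncard.choose 3 * 2 ^ (6 - 3) :=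
    S2.ncard_eRk_eq_le_choose_mul_two_pow M 3 6
      (fun X hX hr => ncard_le_six_of_eRk_le_three_of_free M hfree hX (by exact_mod_cast hr))
  have h2 : {X : Set α | X ⊆ M.E ∧ M.eRk X = (2 : ℕ)}.ncard ≤ M.E.ncard.choose 2 * 2 ^ (3 - 2) :=
    S2.ncard_eRk_eq_le_choose_mul_two_pow M 2 3
      (fun X hX hr => by
        have := ncard_add_one_le_two_pow_of_eRk_le M hL0 hfree 2 X hX hr
        omega)
  have h1 : {X : Set α | X ⊆ M.E ∧ M.eRk X = (1 : ℕ)}.ncard ≤ M.E.ncard.choose 1 * 2 ^ (1 - 1) :=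
    S2.ncard_eRk_eq_le_choose_mul_two_pow M 1 1
      (fun X hX hr => by
        have := ncard_add_one_le_two_pow_of_eRk_le M hL0 hfree 1 X hX hr
        omega)
  have h0 : {X : Set α | X ⊆ M.E ∧ M.eRk X = (0 : ℕ)}.ncard ≤ M.E.ncard.choose 0 * 2 ^ (0 - 0) :=
    S2.ncard_eRk_eq_le_choose_mul_two_pow M 0 0
      (fun X hX hr => by
        have := ncard_add_one_le_two_pow_of_eRk_le M hL0 hfree 0 X hX hr
        omega)
  -- the rank-`5` sets have `≤ 5 + d` points (the nullity cap)
  have h5 : {X : Set α | X ⊆ M.E ∧ M.eRk X = 5}.ncard ≤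
      {B : Set α | B ⊆ M.E ∧ M.eRk B = 5 ∧ B.ncard ≤ 5 + d}.ncard := by
    apply Set.ncard_le_ncard
    · intro X hX
      exact ⟨hX.1, hX.2, ncard_le_add_of_eRk_le_of_encard_eq M hd hX.1 (le_of_eq hX.2)⟩
    · exact M.ground_finite.finite_subsets.subset (fun B hB => hB.1)
  have hD0 := S2.ncard_eRk_eq_ncard_le_le_giant_three_D M 5 (min 19 (5 + d)) (min 10 (4 + d)) ν₁ 6 (5 + d)
    (by norm_num) hcirc hC1 hflat hflat' (hinter_five M hfree) hd (by omega) (by omega) (by omega)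
  simp only [show (5 : ℕ) + 1 = 6 from rfl] at hD0
  rw [hn, sum_Icc_three_six_q, sum_Icc_three_six_q, hm1, hm2, hm3,
    show 5 + d - 6 + 1 = d by omega] at hD0
  simp only [show (6 : ℕ) - 3 = 3 from rfl, show (6 : ℕ) - 4 = 2 from rfl,
    show (6 : ℕ) - 5 = 1 from rfl, show (6 : ℕ) - 6 = 0 from rfl, Nat.choose_one_right,
    Nat.choose_zero_right] at hD0
  have hDq : ({B : Set α | B ⊆ M.E ∧ M.eRk B = 5 ∧ B.ncard ≤ 5 + d}.ncard : ℚ) ≤ ((p + d).choose 5 : ℚ) +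
      (∑ j ∈ Finset.range (d), (Nat.choose (min 13 ((d + 6) / 2 + 1 - 2)) j : ℚ) / (((j + 1) + 3 * (j + 1).choose 2 : ℕ) : ℚ)) *
        ((d * (d + 1) / 2 * (p + d).choose 3 + d * (d + 1) * (d + 2) / 3 * (p + d).choose 2 +
          (d + 4).choose 5 * (p + d) + (d + 5).choose 6 : ℕ) : ℚ) +
      ((∑ j ∈ Finset.range (d), (Nat.choose (min 19 (5 + d) - 6) j : ℚ) / (((j + 1) + 3 * (j + 1).choose 2 : ℕ) : ℚ)) -
        (∑ j ∈ Finset.range (d), (Nat.choose (min 5 (d - 1)) j : ℚ) / (((j + 1) + 3 * (j + 1).choose 2 : ℕ) : ℚ))) *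
        ((d * (d + 1) / 2 * (min 19 (5 + d)).choose 3 + d * (d + 1) * (d + 2) / 3 * (min 19 (5 + d)).choose 2 +
          (d + 4).choose 5 * (min 19 (5 + d)) + (d + 5).choose 6 : ℕ) : ℚ) := by
    have hsm : {C | M.IsCircuit C ∧ C.ncard = 3}.ncard * (p + d).choose 3 +
        {C | M.IsCircuit C ∧ C.ncard = 4}.ncard * (p + d).choose 2 +
        {C | M.IsCircuit C ∧ C.ncard = 5}.ncard * (p + d) + {C | M.IsCircuit C ∧ C.ncard = 6}.ncard * 1 ≤
        d * (d + 1) / 2 * (p + d).choose 3 + d * (d + 1) * (d + 2) / 3 * (p + d).choose 2 +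
          (d + 4).choose 5 * (p + d) + (d + 5).choose 6 := by
      have := hs6
      gcongr
      omega
    have hgg : {C | M.IsCircuit C ∧ C.ncard = 3}.ncard * (min 19 (5 + d)).choose 3 +
        {C | M.IsCircuit C ∧ C.ncard = 4}.ncard * (min 19 (5 + d)).choose 2 +
        {C | M.IsCircuit C ∧ C.ncard = 5}.ncard * (min 19 (5 + d)) + {C | M.IsCircuit C ∧ C.ncard = 6}.ncard * 1 ≤
        d * (d + 1) / 2 * (min 19 (5 + d)).choose 3 + d * (d + 1) * (d + 2) / 3 * (min 19 (5 + d)).choose 2 +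
          (d + 4).choose 5 * (min 19 (5 + d)) + (d + 5).choose 6 := by
      gcongr
      omega
    have hsmq : (({C | M.IsCircuit C ∧ C.ncard = 3}.ncard : ℚ) * ((p + d).choose 3 : ℚ) +
        ({C | M.IsCircuit C ∧ C.ncard = 4}.ncard : ℚ) * ((p + d).choose 2 : ℚ) +
        ({C | M.IsCircuit C ∧ C.ncard = 5}.ncard : ℚ) * ((p + d : ℕ) : ℚ) +
        ({C | M.IsCircuit C ∧ C.ncard = 6}.ncard : ℚ) * ((1 : ℕ) : ℚ)) ≤
        ((d * (d + 1) / 2 * (p + d).choose 3 + d * (d + 1) * (d + 2) / 3 * (p + d).choose 2 +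
          (d + 4).choose 5 * (p + d) + (d + 5).choose 6 : ℕ) : ℚ) := by exact_mod_cast hsm
    have hggq : (({C | M.IsCircuit C ∧ C.ncard = 3}.ncard : ℚ) * ((min 19 (5 + d)).choose 3 : ℚ) +
        ({C | M.IsCircuit C ∧ C.ncard = 4}.ncard : ℚ) * ((min 19 (5 + d)).choose 2 : ℚ) +
        ({C | M.IsCircuit C ∧ C.ncard = 5}.ncard : ℚ) * ((min 19 (5 + d) : ℕ) : ℚ) +
        ({C | M.IsCircuit C ∧ C.ncard = 6}.ncard : ℚ) * ((1 : ℕ) : ℚ)) ≤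
        ((d * (d + 1) / 2 * (min 19 (5 + d)).choose 3 + d * (d + 1) * (d + 2) / 3 * (min 19 (5 + d)).choose 2 +
          (d + 4).choose 5 * (min 19 (5 + d)) + (d + 5).choose 6 : ℕ) : ℚ) := by exact_mod_cast hgg
    have hσ : (∑ j ∈ Finset.range (d), (Nat.choose (min 5 (d - 1)) j : ℚ) / (((j + 1) + 3 * (j + 1).choose 2 : ℕ) : ℚ)) ≤
        ∑ j ∈ Finset.range (d), (Nat.choose (min 19 (5 + d) - 6) j : ℚ) / (((j + 1) + 3 * (j + 1).choose 2 : ℕ) : ℚ) := by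
      apply Finset.sum_le_sum
      intro j _
      have : (min 5 (d - 1)).choose j ≤ (min 19 (5 + d) - 6).choose j := Nat.choose_le_choose j (by omega)
      have h' : ((min 5 (d - 1)).choose j : ℚ) ≤ ((min 19 (5 + d) - 6).choose j : ℚ) := by exact_mod_cast this
      exact div_le_div_of_nonneg_right h' (by positivity)
    have hσm0 : (0 : ℚ) ≤ ∑ j ∈ Finset.range (d), (Nat.choose (min 13 ((d + 6) / 2 + 1 - 2)) j : ℚ) / (((j + 1) + 3 * (j + 1).choose 2 : ℕ) : ℚ) :=
      Finset.sum_nonneg (fun j _ => by positivity)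
    refine hD0.trans ?_
    have e1 := mul_le_mul_of_nonneg_left hsmq hσm0
    have e2 := mul_le_mul_of_nonneg_left hggq (by linarith : (0 : ℚ) ≤
      (∑ j ∈ Finset.range (d), (Nat.choose (min 19 (5 + d) - 6) j : ℚ) / (((j + 1) + 3 * (j + 1).choose 2 : ℕ) : ℚ)) -
        (∑ j ∈ Finset.range (d), (Nat.choose (min 5 (d - 1)) j : ℚ) / (((j + 1) + 3 * (j + 1).choose 2 : ℕ) : ℚ)))
    linarith
  have hB := Matroid.ncard_spanning_le (M := M) hd
  rw [hEcard] at hY hB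
  have hΦ := phiK_le_two_pow_div p 5
  rw [Nat.choose_symm_add] at hΦ
  rw [add_assoc] at hUq
  rw [RLS_iff]
  have hYq : (2 : ℚ) ^ (p + d) ≤ (Matroid.midCount M p 5 : ℚ) +
      ({X : Set α | X ⊆ M.E ∧ M.eRk X ≤ 5}.ncard : ℚ) +
      ({X : Set α | X ⊆ M.E ∧ M.eRk X = M.eRank}.ncard : ℚ) := by exact_mod_cast hY
  have hU0' : (0 : ℚ) ≤ (Matroid.topCount M p 5 : ℚ) := Nat.cast_nonneg _
  have hd5 : 5 ≤ d := by omega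
  -- `#{r ≤ 5} ≤ F₄(n) + count₅` in `ℚ`
  norm_num [Nat.choose_one_right] at h4 h3 h2 h1 h0
  rw [hn] at h4 h3 h2 h1
  have hAq : ({X : Set α | X ⊆ M.E ∧ M.eRk X ≤ 5}.ncard : ℚ) ≤
      (((p + d).choose 4 * 2 ^ 6 + (p + d).choose 3 * 2 ^ 3 + (p + d).choose 2 * 2 + (p + d) + 1 : ℕ) : ℚ) +
      (((p + d).choose 5 : ℚ) +
        (∑ j ∈ Finset.range (d), (Nat.choose (min 13 ((d + 6) / 2 + 1 - 2)) j : ℚ) / (((j + 1) + 3 * (j + 1).choose 2 : ℕ) : ℚ)) *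
          ((d * (d + 1) / 2 * (p + d).choose 3 + d * (d + 1) * (d + 2) / 3 * (p + d).choose 2 +
            (d + 4).choose 5 * (p + d) + (d + 5).choose 6 : ℕ) : ℚ) +
        ((∑ j ∈ Finset.range (d), (Nat.choose (min 19 (5 + d) - 6) j : ℚ) / (((j + 1) + 3 * (j + 1).choose 2 : ℕ) : ℚ)) -
          (∑ j ∈ Finset.range (d), (Nat.choose (min 5 (d - 1)) j : ℚ) / (((j + 1) + 3 * (j + 1).choose 2 : ℕ) : ℚ))) *
          ((d * (d + 1) / 2 * (min 19 (5 + d)).choose 3 + d * (d + 1) * (d + 2) / 3 * (min 19 (5 + d)).choose 2 +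
            (d + 4).choose 5 * (min 19 (5 + d)) + (d + 5).choose 6 : ℕ) : ℚ)) := by
    have hA4 : {X : Set α | X ⊆ M.E ∧ M.eRk X ≤ 5}.ncard ≤
        ((p + d).choose 4 * 2 ^ 6 + (p + d).choose 3 * 2 ^ 3 + (p + d).choose 2 * 2 + (p + d) + 1) +
        {B : Set α | B ⊆ M.E ∧ M.eRk B = 5 ∧ B.ncard ≤ 5 + d}.ncard := by
      push_cast at hsum5
      omega
    have hA4q : ({X : Set α | X ⊆ M.E ∧ M.eRk X ≤ 5}.ncard : ℚ) ≤
        (((p + d).choose 4 * 2 ^ 6 + (p + d).choose 3 * 2 ^ 3 + (p + d).choose 2 * 2 + (p + d) + 1 : ℕ) : ℚ) +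
        ({B : Set α | B ⊆ M.E ∧ M.eRk B = 5 ∧ B.ncard ≤ 5 + d}.ncard : ℚ) := by exact_mod_cast hA4
    exact hA4q.trans (add_le_add le_rfl hDq)
  have hBq : ({X : Set α | X ⊆ M.E ∧ M.eRk X = M.eRank}.ncard : ℚ) ≤
      ((∑ j ∈ Finset.range (d + 1), (p + d).choose j : ℕ) : ℚ) := by exact_mod_cast hB
  have hpolyq := level_five_poly_three d hd6 hd25 p hp
  rw [add_assoc] at hpolyq
  rcases Nat.lt_or_ge d 19 with hd18 | hd19
  · -- coranks `6 … 18`: the structured tail from `n ≥ 30 + d`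
    have hT := S2.sixteen_mul_tail_three_small d hd6 (by omega) (p + d) (by omega)
    have hABq : 16 * (({X : Set α | X ⊆ M.E ∧ M.eRk X ≤ 5}.ncard : ℚ) +
        ({X : Set α | X ⊆ M.E ∧ M.eRk X = M.eRank}.ncard : ℚ)) ≤ 2 ^ (p + d) := by linarith
    exact S2.level_arith16 (p := p) (d := d) (n := p + d) (q := 5) rfl hd5 hΦ hU0' hUq hYq hABq hpolyq
  · rcases Nat.lt_or_ge (p + d) (2 * d + 14) with hII | hT0
    · -- the 42 regime-II cells: one middle binomial
      obtain ⟨s, hs1, hs2, hnum⟩ := S2.level_five_cells_II3 d p hd19 hd25 hp hII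
      have hYII : (((p + d).choose s : ℕ) : ℚ) ≤ (Matroid.midCount M p 5 : ℚ) := by
        have h := choose_le_midCount_of_bound' M hfree (q := 5) (p := p) (B := 19) (s := s)
          (fun X hX hr => ncard_le_nineteen_of_eRk_le_five_of_free M hfree hX hr) (by omega) hs2
        rw [hEcard] at h
        exact_mod_cast h
      rw [add_assoc] at hnum
      exact level_arith_II3 hΦ hU0' hUq hYII hnum
    · -- coranks `19 … 25` above the bases `n ≥ 2d + 14`
      have hT := S2.sixteen_mul_tail_three_large d hd19 hd25 (p + d) hT0
      have hABq : 16 * (({X : Set α | X ⊆ M.E ∧ M.eRk X ≤ 5}.ncard : ℚ) +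
          ({X : Set α | X ⊆ M.E ∧ M.eRk X = M.eRank}.ncard : ℚ)) ≤ 2 ^ (p + d) := by linarith
      exact S2.level_arith16 (p := p) (d := d) (n := p + d) (q := 5) rfl hd5 hΦ hU0' hUq hYq hABq hpolyq

/-- **THEOREM C₅, THE «31» CHAIN, GIVEN LEVEL `4` FROM `P`**: for every `P ≥ 30`, level `4` for all `p ≥ P` implies
level `5` for all `p ≥ P + 1` (the S2 reduction `rls_five_of_four_of_core P`: coranks `6 … 25` by the cells at
`p ≥ P ≥ 30`, `≥ 26` by `c025_core_five_nineteen`). -/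
theorem c025_five_of_four_three_from (P : ℕ) (hP : 30 ≤ P)
    (h4 : ∀ (M : Matroid α) [M.Finite] (p : ℕ), P ≤ p → RLS M p 4) :
    ∀ (M : Matroid α) [M.Finite] (p : ℕ), P + 1 ≤ p → RLS M p 5 := by
  refine S2.rls_five_of_four_of_core P (by omega) h4 ?_
  intro M _ p hP' hR hbig hfree
  rcases Nat.lt_or_ge M.E.ncard (p + 26) with h | h
  · exact c025_core_five_bounded_corank_three M p (M.E.ncard - p) (by omega) (by omega) (by omega) hR (by omega) hfree
  · exact c025_core_five_nineteen M p (by omega) hR (by omega) hfree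

/-- **THEOREM C₅ AT `31`, UNCONDITIONAL**: every finite matroid satisfies C-025 at level `5` for every `p ≥ 31` (level
`4` from S1's `c025_four_twentyseven`, `p ≥ 27`, through the «31» chain from `P = 30`). -/
theorem c025_five_large_three31 (M : Matroid α) [M.Finite] (p : ℕ) (hp : 31 ≤ p) : RLS M p 5 :=
  c025_five_of_four_three_from 30 le_rfl (fun M _ p hp => S1.c025_four_twentyseven M p (by omega)) M p hp

/-- The level-`5` statement at `p ≥ 31` in the vocabulary of `C025`. -/
theorem c025_five_large_three31' (M : Matroid α) [M.Finite] (p : ℕ) (hp : 31 ≤ p) :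
    phiK p 5 * ({A : Set α | A ⊆ M.E ∧ M.eRk A = (p : ℕ∞) ∧ M.eRk (M.E \ A) = (5 : ℕ∞)}.ncard : ℚ) ≤
      ({A : Set α | A ⊆ M.E ∧ (5 : ℕ∞) < M.eRk A ∧ M.eRk A < (p : ℕ∞)}.ncard : ℚ) :=
  c025_five_large_three31 M p hp

end ThmN

end PercRepro
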